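import Summits.CriticalPhenomena.SAWScalingLimit.Theorems.SAWLoopFugacityFlowSimpleSubseqLimitsRouteResidual
import HarnessLib

/-!
# Line `rooted-restriction-values` — crux `SimpleSubseqLimits` (stmt-CriticalPhenomena-4982)

Skeleton line registered by the crux strategist (wall-breaker seat `cstrat-stmt-CriticalPhenomena-4982-p1`,
2026-08-17) for the crux decl
`Summit.CriticalPhenomena.SAWScalingLimit.Theses.SAWLoopFugacityFlow.SimpleSubseqLimits`.
It builds the fourth triaged idea of round 1, `Ideas/slit-continuous-restriction.md` (TRIAGE-r1-{1,2,3}: pass;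
never given a line planner before today), in the typing the triage asked for (punctured lattice slit
domains, Carathéodory KERNEL convergence with respect to an interior base point, roots pinned by ACCESS
PATHS — no uniformiser of the lattice domain is ever required, so the doubly connected slit graphs of
interior roots, Disproof §13, are inside the hypothesis class), with the open content pushed to the
VALUE-ful, engine-facing statement `RootedAvoidanceLimit` (C⁺).

SIBLING LINE (same door, registered minutes earlier by strategist seat s1):
`Lines/slit_continuous_restriction.lean` (namespace `…Cruxes.SimpleSubseqLimits.SlitContinuousRestriction`),
whose open stub `stub_seqSlitAvoidance : SequentialSlitAvoidance` is the VALUE-FREE conditional shadow of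
this line's input: on paper `RootedAvoidanceLimit ∧ FarHullVanish` + the exact domain Markov identity ⇒
`SequentialSlitAvoidance` at generic entrance radii (tip = endpoint of the limit arc). The two skeletons share
the closing (guarded Rohde–Schramm + SHAPE) and differ in where the research content sits: there, a
conditional avoidance BOUND stated on the original law (no Markov identity, no conformal map needed to state
it; an engine must still be found for it); here, the avoidance VALUES in rooted-kernel-convergent domains —
the native output of any A-side engine — from which the A-side crux stmt-10649 itself also follows
(`stub_avoidanceLimit_of_rooted`), so that ONE input carries both open cruxes of the route.

## The line in one paragraph

ORDER (no macroscopic retracing of subsequential limits) is converted into SHAPE statements about ONE curve in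
VARYING domains. On the lattice the future of the critical SAW after its first entrance into a closed ball is,
exactly, the critical SAW of the slit graph from the tip (domain Markov, landed: `…StubDomainMarkov*`,
`…StubForbiddenDomainMarkov`). The input `RootedAvoidanceLimit` (C⁺, the A-side crux `AvoidanceLimit`
stmt-10649 made continuous along rooted-kernel-convergent sequences of lattice domains) says that hull-avoidance
probabilities of such slit walks converge to the SLE_{8/3} restriction values `Φ'_A(0)^{5/8}` of the LIMIT slit
domain. Against the limit law `ν` of a subsequential limit (Skorokhod coupling, generic radii) this gives, by a
reverse-Fatou/conditional argument, `ν(far return at (q, r)) ≤ E_ν[1 - d_ε(γ)^{5/8}]` for every thickening width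
`ε`, where `d_ε(γ)` is the restriction derivative of the thin hull hugging the FAR part of the slit of the limit
past `γ[0, τ]`; `d_ε(γ) → 1` for each `γ` (`FarHullVanish`: Brownian-excursion / SLE_{8/3} boundary avoidance in
derivative form), so dominated convergence gives `ν(far return) = 0` (`NoFarReturn`). No uniformity over pasts
is ever claimed (the gating objection (O5) of the dead lattice lines is dissolved by integrating against `ν`),
no crossing/G-type bound is used (O2), the interior-root island is absorbed by kernel convergence (O4), and the
closing is the LANDED guarded Rohde–Schramm lemma `FarPast.Passage.mem_simple_of_forall_notMem_farReturnEvent`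
together with SHAPE `PastShadowing.Main.rangeArc_of_avoidanceValues` (boundary clause) — proved below as
`simpleSubseqLimits_of_noFarReturn`, so the composition `SimpleSubseqLimits_of` is kernel-checked.

## Registered stubs

* `stub_rootedAvoidanceLimit : RootedAvoidanceLimit` — THE INPUT (C⁺). Engine: whatever proves `AvoidanceLimit`
  (this route: Ising-anchored loop-fugacity continuation; siblings: SteinDefect, TensorRG, FrontierHomotopy),
  run domain-uniformly as every lattice → SLE theorem in print is (Chelkak–Smirnov compactness/identification;
  LSW04's LERW theorem is uniform over grid domains). Strictly stronger than stmt-10649, NOT implied by the summit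
  as typed (diagonal domain sequences), not equivalent to the crux.
* `stub_avoidanceLimit_of_rooted : RootedAvoidanceLimit → AvoidanceLimit` — constant-domain extraction
  (Carathéodory extension for the Jordan domain pins the roots; open/closed hull sandwich by
  `HasRestrictionDeriv.tendsto_of_kernel`-type continuity). Delivers the SHAPE input of the transfer.
* `stub_farHullVanish : FarHullVanish` — deterministic conformal geometry: for a Jordan domain slit by a simple
  arc from `a`, thin hulls hugging a closed initial sub-arc not reaching the tip have restriction derivative → 1.
* `stub_conditionalRestriction : RootedAvoidanceLimit → FarHullVanish → AvoidanceLimit → NoFarReturn` — the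
  transfer (Skorokhod representation on the Polish `CurveClass ℂ`; generic entrance radii à la
  `FirstHitFlatGuard`; exact domain Markov in punctured convention; verification of (K1)(K2) and of the access
  paths — the free segment towards the ball centre at a first entrance, a Carathéodory path at `b`; reverse
  Fatou; `FarHullVanish` + dominated convergence; far pasts containing `b` handled through the first visit of
  `b` or time reversal of the law).

Disproof used: the crux's load-bearing hypotheses (`_false_without_tendsto_fst/snd`, `_false_without_meshLimit`,
`_false_without_weakLimit`, Disproof §2/§12) enter verbatim through `IsSubseqLimit`; §13 (interior roots) is in
the hypothesis class of C⁺ by design; §4/§7/§15 (no soft road; range-blindness; order-blind kisses) are respected: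
the ORDER input is C⁺ + Markov, SHAPE is used for the boundary clause and for the slit geometry, and the closing
is the far-return (retrace-catching) lemma, not a range functional.
-/

noncomputable section

open MeasureTheory Filter Topology Set Metric Function
open Literature.Probability.RandomPlanarGeometry Literature.Probability.RandomPlanarGeometry.SAW
open Literature.Probability.LatticeModels
open UpperHalfPlane (upperHalfPlaneSet)
open scoped ENNReal NNReal BoundedContinuousFunction unitInterval

namespace Summit.CriticalPhenomena.SAWScalingLimit.Cruxes.SimpleSubseqLimits.RootedRestrictionValues

open Summit.CriticalPhenomena.SAWScalingLimit.Theses.SAWLoopFugacityFlow (SimpleSubseqLimits AvoidanceLimit)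
open Summit.CriticalPhenomena.SAWScalingLimit.Theorems.SimpleSubseqLimits.Negative
  (WeakLimitAlong simpleSubseqLimits_iff_core ae_source_target_range_of_weakLimitAlong)
open Summit.CriticalPhenomena.SAWScalingLimit.Theorems.SimpleSubseqLimits.MarkedPointRevisit.Passage
  (IsSubseqLimit)
open Summit.CriticalPhenomena.SAWScalingLimit.Theorems.SimpleSubseqLimits.PastShadowing.Main
  (AvoidanceValues RangeArc rangeArc_of_avoidanceValues)
open Summit.CriticalPhenomena.SAWScalingLimit.Theorems.SimpleSubseqLimits.FirstHit.Passage
  (gaussRat countable_gaussRat)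
open Summit.CriticalPhenomena.SAWScalingLimit.Theorems.SimpleSubseqLimits.FarPast.Passage
  (farReturnEvent mem_simple_of_forall_notMem_farReturnEvent)
open Summit.CriticalPhenomena.SAWScalingLimit.Theorems.SimpleSubseqLimits.FarPast.RouteResidual
  (avoidanceValues_of_avoidanceLimit)

/-! ## Vocabulary -/

/-- **Rooted kernel convergence** of the lattice domains `(V n; t n, b n)` at meshes `δ n` to the rooted slit
domain `(D ∖ K; tLim, b)`, `b = D.pt 1`, seen through a chordal uniformiser `ψ : ℍ → D ∖ K` (`0 ↦ tLim`, `∞ ↦ b`):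
the `V n` are open subsets of `D` in which the lattice roots are joined; (K1)/(K2) are the two halves of
Carathéodory kernel convergence exactly as in `Literature…CaratheodoryKernelPointwise` (every compact of the
limit domain is eventually inside; no disc about a point outside the limit domain is eventually inside); and
the two roots are pinned to the prime ends `0`, `∞` of the limit domain by ACCESS PATHS: continuous paths from
the lattice roots inside `V n` converging uniformly to paths entering the limit domain, whose `ψ`-preimages tend
to `0`, resp. to `∞`. No uniformiser of `V n` is asked for (the `V n` may be multiply connected: island pasts
of interior roots, Disproof §13, lattice pockets and punctures). [folklore] -/
def RootedKernelLimit (D : DobrushinDomain) (K : Set ℂ)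
    (ψ : ConformalEquiv upperHalfPlaneSet (D.carrier \ K)) (tLim : ℂ)
    (V : ℕ → Set ℂ) (δ : ℕ → ℝ) (t b : ℕ → Site 2) : Prop :=
  (∀ n, IsOpen (V n)) ∧ (∀ n, V n ⊆ D.carrier) ∧
  (∀ n, (discreteDomainGraph (V n) (δ n)).Reachable (t n) (b n)) ∧
  (∀ C : Set ℂ, IsCompact C → C ⊆ D.carrier \ K → ∀ᶠ n in atTop, C ⊆ V n) ∧
  (∀ p : ℂ, p ∉ D.carrier \ K → ∀ r : ℝ, 0 < r → ∀ᶠ n in atTop, ¬ (ball p r ⊆ V n)) ∧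
  (∃ (c : ℕ → C(I, ℂ)) (cLim : C(I, ℂ)), (∀ n, c n 0 = meshPoint (δ n) (t n)) ∧
    (∀ n, range (c n) ⊆ V n) ∧ TendstoUniformly (fun n => ⇑(c n)) cLim atTop ∧ cLim 0 = tLim ∧
    (∀ s : I, 0 < s → cLim s ∈ D.carrier \ K) ∧
    Tendsto (fun s : I => ψ.symm (cLim s)) (𝓝[>] 0) (𝓝 0)) ∧
  (∃ (e : ℕ → C(I, ℂ)) (eLim : C(I, ℂ)), (∀ n, e n 0 = meshPoint (δ n) (b n)) ∧
    (∀ n, range (e n) ⊆ V n) ∧ TendstoUniformly (fun n => ⇑(e n)) eLim atTop ∧ eLim 0 = D.pt 1 ∧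
    (∀ s : I, 0 < s → eLim s ∈ D.carrier \ K) ∧
    Tendsto (fun s : I => ‖ψ.symm (eLim s)‖) (𝓝[>] 0) atTop)

/-- **C⁺ — ROOTED (kernel-continuous) AVOIDANCE LIMIT.** For every Dobrushin domain `D = (Ω; a, b)`, compact
`K` with a chordal uniformiser `ψ : ℍ → Ω ∖ K` (`0 ↦ tLim`, `∞ ↦ b`; vacuous when `K` disconnects `Ω`), every
sequence of open lattice domains `V n ⊆ Ω` at meshes `δ n → 0⁺` with roots `t n`, `b n` converging to
`(Ω ∖ K; tLim, b)` in the rooted kernel sense, and every OPEN set `O` whose closure misses `tLim` and `b`, the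
critical-SAW probability of avoiding `O` in `V n` from `t n` to `b n` converges to `Φ'_A(0)^{5/8}`, `A` the
hull of `ℍ` cut out by `O` through `ψ` (pulled back verbatim as in `AvoidanceLimit`, stmt-10649), `Φ_A` its
normalised restriction map (`IsRestrictionMap`, `HasRestrictionDeriv`). The A-side crux made CONTINUOUS IN THE
ROOTED DOMAIN — LSW04 Prediction 1 / §3.4.5 in the form in which lattice → SLE theorems are proved
(Chelkak–Smirnov: uniformly along Carathéodory-convergent discrete domains; LSW04 LERW Thm 1.1: uniformly over
grid domains). OPEN input of this line (deliberately untagged: not a literature fact; strictly stronger than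
stmt-10649; not implied by the summit as typed). -/
def RootedAvoidanceLimit : Prop :=
  ∀ (D : DobrushinDomain) (K : Set ℂ) (ψ : ConformalEquiv upperHalfPlaneSet (D.carrier \ K)) (tLim : ℂ)
    (V : ℕ → Set ℂ) (δ : ℕ → ℝ) (t b : ℕ → Site 2),
    IsCompact K → ψ.HasBoundaryValue 0 tLim → ψ.HasBoundaryValueAtInfty (D.pt 1) →
    Tendsto δ atTop (𝓝[>] (0 : ℝ)) → RootedKernelLimit D K ψ tLim V δ t b →
    ∀ (O : Set ℂ), IsOpen O → tLim ∉ closure O → D.pt 1 ∉ closure O →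
    ∀ (A : Set ℂ), A = closure (upperHalfPlaneSet \
        {z | z ∈ upperHalfPlaneSet ∧ ψ z ∈ (D.carrier \ K) \ closure O}) →
    ∀ (Φ : ConformalEquiv (upperHalfPlaneSet \ A) upperHalfPlaneSet) (d : ℝ),
      IsRestrictionMap A Φ → HasRestrictionDeriv A Φ d →
      Tendsto (fun n => ((SAW.law (V n) (δ n) (t n) (b n)).map (fun γ => γ.curve))
          (CurveClass.rangeSubset Oᶜ)) atTop (𝓝 (ENNReal.ofReal (d ^ ((5 : ℝ) / 8))))

/-- **FAR HULLS VANISH** (deterministic; SLE_{8/3}/excursion boundary avoidance in restriction-derivative form):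
slit the Jordan domain `Ω` by a simple arc `e` from `a = e 0` meeting `∂Ω` only at `a`, root the slit domain
at the tip `e 1` and at `b`, and let `F = e [0, s₀]`, `s₀ < 1`, be a closed initial sub-arc (the FAR past; it
misses the tip and `b`). Then for every `η > 0` there are a width `ε > 0` and an open `O ⊇ (ε-thickening of F)`
with closure missing tip and `b`, whose pulled-back hull carries a restriction map with derivative
`d > 1 - η`: thin hulls hugging a boundary arc away from `0` and `∞` have `Φ'_A(0) → 1` (monotonicity of
`A ↦ Φ'_A(0)`, properness of `ψ` at the two prime ends, anchored fill `Literature.anchoredHull`). Route-local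
statement (untagged); classical content: LSW03 §2–3 (`Φ'_A(0) = P[excursion avoids A]`), Pommerenke Thm 2.6.
-/
def FarHullVanish : Prop :=
  ∀ (D : DobrushinDomain) (e : C(I, ℂ)) (s₀ : I)
    (ψ : ConformalEquiv upperHalfPlaneSet (D.carrier \ range e)),
    Injective e → e 0 = D.pt 0 → range e ∩ frontier D.carrier = {D.pt 0} → s₀ < 1 →
    ψ.HasBoundaryValue 0 (e 1) → ψ.HasBoundaryValueAtInfty (D.pt 1) →
    ∀ η : ℝ, 0 < η → ∃ ε : ℝ, 0 < ε ∧ ∃ O : Set ℂ, IsOpen O ∧ thickening ε (e '' Icc 0 s₀) ⊆ O ∧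
      e 1 ∉ closure O ∧ D.pt 1 ∉ closure O ∧
      ∀ (A : Set ℂ), A = closure (upperHalfPlaneSet \
          {z | z ∈ upperHalfPlaneSet ∧ ψ z ∈ (D.carrier \ range e) \ closure O}) →
        ∃ (Φ : ConformalEquiv (upperHalfPlaneSet \ A) upperHalfPlaneSet) (d : ℝ),
          IsRestrictionMap A Φ ∧ HasRestrictionDeriv A Φ d ∧ 1 - η < d

/-- **NO FAR RETURN** (the ORDER half of the crux at the LIMIT level, in the landed far-return vocabulary of
`FarPast.Passage`): every subsequential weak limit `ν` of the critical SAW laws along an endpoint approximation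
gives mass `0` to every exact far first-hit return event with Gaussian-rational centre and positive rational
radius. By the landed guarded Rohde–Schramm lemma this is `ν`-a.e. simplicity; conversely it follows from the
crux (far returns of a flat curve do not exist). Route-local (untagged). -/
def NoFarReturn : Prop :=
  ∀ (D : DobrushinDomain) (a b : ℝ → Site 2), IsEndpointApprox D a b →
    ∀ (s : ℕ → ℝ) (ν : Measure (CurveClass ℂ)), IsSubseqLimit D a b s ν →
      ∀ q ∈ gaussRat, ∀ r : ℚ, 0 < r → ν (farReturnEvent q r) = 0

/-! ## Registered stubs -/

/-- STUB 1 — THE INPUT C⁺ (hardest; open, engine = the A-side engine run domain-uniformly). -/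
theorem stub_rootedAvoidanceLimit : RootedAvoidanceLimit := by
  sorry

/-- STUB 2 — constant-domain extraction: C⁺ specialises to the A-side crux `AvoidanceLimit` (stmt-10649)
(`V n = Ω`, roots `a(δ n), b(δ n)` pinned by Carathéodory's homeomorphic extension for the Jordan domain;
the closed event `range ⊆ cl D'` of stmt-10649 sandwiched between open avoidance events with hulls whose
derivatives converge, `AvoidancePassage` pattern). -/
theorem stub_avoidanceLimit_of_rooted : RootedAvoidanceLimit → AvoidanceLimit := by
  sorry

/-- STUB 3 — far hulls vanish (deterministic conformal geometry of slit domains). -/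
theorem stub_farHullVanish : FarHullVanish := by
  sorry

/-- STUB 4 — THE TRANSFER (conditional restriction): C⁺ + far hulls vanish + SHAPE (from `AvoidanceLimit`,
landed `rangeArc_of_avoidanceValues`) ⇒ no far return for subsequential limits. Skorokhod coupling on the
Polish `CurveClass ℂ`; generic entrance radius `r' ∈ (r, 2r)` (first hits of the closed and open ball agree
`ν`-a.s., countably many exceptions per curve); exact domain Markov at the first lattice vertex in
`B̄(q, r')` in punctured convention (`V = Ω` minus closed `δ/3`-balls at the past vertices minus the cells of
the non-tip components — `discreteDomainGraph V δ` is then the tip component of `Ω_δ` minus the prefix);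
(K1)(K2) from uniform convergence of the pasts and SHAPE; tip access along the free segment towards `q`,
target access by Carathéodory at `b`; reverse Fatou `limsup_n E[F_n(γ_n)] ≤ E_ν[limsup_n F_n]`; C⁺ along the
coupled slit domains with `O ⊇` the `ε`-thickening of the far sub-arc supplied by `FarHullVanish`; dominated
convergence in `η → 0`; far pasts meeting `b` reduced to the first visit of `b` (or handled by time reversal
of the law). -/
theorem stub_conditionalRestriction :
    RootedAvoidanceLimit → FarHullVanish → AvoidanceLimit → NoFarReturn := by
  sorry

/-! ## The closing, proved: no far return + the A-side ⇒ the crux -/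

/-- **CLOSING (proved).** `NoFarReturn` and the A-side crux `AvoidanceLimit` give the crux: simplicity
`ν`-a.e. by the landed guarded Rohde–Schramm lemma `FarPast.Passage.mem_simple_of_forall_notMem_farReturnEvent`
(the countably many exact far-return events are null, the endpoints `a ≠ b` are free), the boundary clause
`ν`-a.e. from SHAPE (`rangeArc_of_avoidanceValues`, A-side supports discharged by
`avoidanceValues_of_avoidanceLimit`), endpoints and confinement free (`simpleSubseqLimits_iff_core`).
[folklore] -/
theorem simpleSubseqLimits_of_noFarReturn (hN : NoFarReturn) (hA : AvoidanceLimit) :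
    SimpleSubseqLimits := by
  have hAV : AvoidanceValues := avoidanceValues_of_avoidanceLimit hA
  refine simpleSubseqLimits_iff_core.2 fun D a b hab s ν hs hν hw => ?_
  haveI := hν
  have hshape := rangeArc_of_avoidanceValues hAV D a b hab s ν hs hν hw
  have hfree := ae_source_target_range_of_weakLimitAlong (ν := ν) hab hs hw
  haveI : Countable gaussRat := countable_gaussRat.to_subtype
  have hnull : ∀ᵐ c ∂ν, ∀ q : gaussRat, ∀ r : {x : ℚ // 0 < x},
      c ∉ farReturnEvent (q : ℂ) (r : ℚ) := by
    rw [ae_all_iff]; intro q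
    rw [ae_all_iff]; intro r
    exact measure_eq_zero_iff_ae_notMem.1 (hN D a b hab s ν ⟨hs, hν, hw⟩ (q : ℂ) q.2 (r : ℚ) r.2)
  filter_upwards [hfree, hnull, hshape] with c hc hn hsh
  refine ⟨mem_simple_of_forall_notMem_farReturnEvent c (fun q hq r hr => hn ⟨q, hq⟩ ⟨r, hr⟩) ?_, hsh.2⟩
  rw [hc.1, hc.2.1]
  exact fun h => absurd (D.pt_injective h) (by decide)

/-! ## Composition (kernel-checked): the four stubs conclude the crux BY NAME -/

/-- **COMPOSITION.** `RootedAvoidanceLimit` (C⁺) → (C⁺ → `AvoidanceLimit`) → `FarHullVanish` →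
(C⁺ → `FarHullVanish` → `AvoidanceLimit` → `NoFarReturn`) → the crux
`Summit.CriticalPhenomena.SAWScalingLimit.Theses.SAWLoopFugacityFlow.SimpleSubseqLimits`. [folklore] -/
theorem SimpleSubseqLimits_of :
    RootedAvoidanceLimit →
    (RootedAvoidanceLimit → AvoidanceLimit) →
    FarHullVanish →
    (RootedAvoidanceLimit → FarHullVanish → AvoidanceLimit → NoFarReturn) →
    Summit.CriticalPhenomena.SAWScalingLimit.Theses.SAWLoopFugacityFlow.SimpleSubseqLimits :=
  fun h1 h2 h3 h4 => simpleSubseqLimits_of_noFarReturn (h4 h1 h3 (h2 h1)) (h2 h1)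

/-- The same with the registered stubs plugged in (sorries live only inside `stub_*`). [folklore] -/
theorem simpleSubseqLimits_of_stubs :
    Summit.CriticalPhenomena.SAWScalingLimit.Theses.SAWLoopFugacityFlow.SimpleSubseqLimits :=
  SimpleSubseqLimits_of stub_rootedAvoidanceLimit stub_avoidanceLimit_of_rooted stub_farHullVanish
    stub_conditionalRestriction

end Summit.CriticalPhenomena.SAWScalingLimit.Cruxes.SimpleSubseqLimits.RootedRestrictionValues

end
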